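import Literature.Algebra.EuclideanLattices.PQCLLL
import Literature.Algebra.EuclideanLattices.LLLAlgorithmTermination
import Literature.Algebra.EuclideanLattices.LLLMachineMain
import HarnessLib

/-!
# Towards `Literature.Algebra.EuclideanLattices.lll_polyTime` (LLL82 Prop. 1.26): the assembly step

Sibling proof file of `PQCLLL.lean` (D-0014) for its last named fact `Literature.Algebra.EuclideanLattices.lll_polyTime`
(the other facts of `PQCLLL.lean`, LLL82 Props. 1.6–1.12, are discharged in `PQCLLLProofs.lean`). The named fact `Literature.Algebra.EuclideanLattices.lll_polyTime` asks for a
`Turing.TM2ComputableInPolyTime` function on bit-encoded lattice instances returning an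
LLL-reduced (`δ = 3/4`) basis of the same lattice. `LLLAlgorithm.lean` formalises LLL82's
algorithm (`Literature.Algebra.EuclideanLattices.lllStep`, `Literature.Algebra.EuclideanLattices.LatticeInstance.lllReduce`) and decomposes the
printed proof of LLL82 Prop. 1.26 into named facts. This file proves the assembly:

* `Literature.Algebra.EuclideanLattices.lll_polyTime_of`: `lll_polyTime` follows from the loop invariant
  (`isLLLReduced_of_halted`, Bremner 2011 Lemma 4.13), the termination bound
  (`lll_halts_within`, LLL82 proof of Prop. 1.26 / Bremner Thm. 4.19) and the machine-level
  running time (`lllReduce_polyTime`: a polynomial-time function agreeing with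
  `LatticeInstance.lllReduce` on nonsingular instances), using the *proved* lattice invariance
  `LatticeInstance.lllReduce_lattice`; the witness is the function of `lllReduce_polyTime`.
* `Literature.Algebra.EuclideanLattices.lll_polyTime_of_lllReduce_polyTime`: the same with the loop invariant and the
  termination bound discharged (`isLLLReduced_of_halted_holds`, `LLLAlgorithmInvariant.lean`;
  `lll_halts_within_holds`, `LLLAlgorithmTermination.lean`), so that `lll_polyTime` is reduced
  to the single machine-level fact `lllReduce_polyTime`.

When `lllReduce_polyTime` is discharged (`lllReduce_polyTime_holds`), `lll_polyTime_holds` is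
the one-line corollary, to be appended here.

## References

* A. K. Lenstra, H. W. Lenstra Jr., L. Lovász, *Factoring polynomials with rational
  coefficients*, Math. Ann. 261 (1982), Prop. 1.26.
* M. R. Bremner, *Lattice Basis Reduction*, CRC Press 2011, Ch. 4 (Lemma 4.13, Thm. 4.19,
  Thms. 4.22–4.23).
-/

noncomputable section

namespace Literature.Algebra.EuclideanLattices

open Literature.Computability.Complexity

/-- **Assembly of LLL82 Prop. 1.26.** If (i) halted iterates of the LLL loop carry LLL-reduced
families (loop invariant, Bremner Lemma 4.13), (ii) on linearly independent integer vectors with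
`‖bᵢ‖² ≤ B` the loop with `δ = 3/4` halts within `(n-1) + 2⌊(n(n-1)/2) log B / log(4/3)⌋`
passes (LLL82, proof of Prop. 1.26; Bremner Thm. 4.19), and (iii) some polynomial-time function
on the bit encoding agrees with `LatticeInstance.lllReduce` on nonsingular instances (LLL82
Prop. 1.26), then `lll_polyTime` holds, with that function as witness; the lattice is preserved
by the proved `LatticeInstance.lllReduce_lattice`. [cite: LenstraLenstraLovasz1982, Prop. 1.26] [cite: Bremner2011, Lemma 4.13 and Thm. 4.19] -/
theorem lll_polyTime_of
    (hred : ∀ m : ℕ, isLLLReduced_of_halted (intVecToEuclidean m).toAddMonoidHom)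
    (hhalt : lll_halts_within) (hpoly : lllReduce_polyTime) : lll_polyTime := by
  obtain ⟨f, hf, hfI⟩ := hpoly
  refine ⟨f, polyTimeComputable_iff_nonempty.1 hf, fun I hI => ?_⟩
  refine ⟨I.lllReduce.basis, ?_, I.lllReduce_lattice, ?_⟩
  · rw [hfI I hI]; rfl
  -- the hypotheses of the termination fact, with `B = ∑ᵢ ‖bᵢ‖²`
  set φ := (intVecToEuclidean I.n).toAddMonoidHom with hφ
  have hli : LinearIndependent ℝ (⇑(intVecToEuclidean I.n) ∘ I.basis) :=
    LatticeInstance.linearIndependent_vec hI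
  set B : ℝ := ∑ i, ‖intVecToEuclidean I.n (I.basis i)‖ ^ 2 with hB
  have hBi : ∀ i, ‖intVecToEuclidean I.n (I.basis i)‖ ^ 2 ≤ B := fun i =>
    Finset.single_le_sum (f := fun i => ‖intVecToEuclidean I.n (I.basis i)‖ ^ 2)
      (fun j _ => sq_nonneg _) (Finset.mem_univ i)
  have hhalted := hhalt (3 / 4) B I.basis (by norm_num) (by norm_num) hli hBi
  have hinv := hred I.n (3 / 4) I.basis _ hhalted
  rw [← lllResult_eq_of_halted φ hhalted] at hinv
  exact hinv

/-- **LLL82 Prop. 1.26, reduced to the machine.** With the loop invariant (Bremner Lemma 4.13)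
and the termination bound (LLL82, proof of Prop. 1.26; Bremner Thm. 4.19) now proved, the named
fact `lll_polyTime` follows from the single machine-level fact `lllReduce_polyTime` (a
polynomial-time function agreeing with `LatticeInstance.lllReduce` on nonsingular instances).
[cite: LenstraLenstraLovasz1982, Prop. 1.26] [cite: Bremner2011, Lemma 4.13 and Thm. 4.19] -/
theorem lll_polyTime_of_lllReduce_polyTime (hpoly : lllReduce_polyTime) : lll_polyTime :=
  lll_polyTime_of (fun _ => isLLLReduced_of_halted_holds _) lll_halts_within_holds hpoly

/-- **LLL82 Proposition 1.26, discharged**: there is a polynomial-time `TM2` machine which maps the code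
of every nonsingular integer lattice instance `⟨n, B⟩` to the code of an instance `⟨n, B'⟩` generating the
same lattice and `3/4`-LLL-reduced — by `lll_polyTime_of_lllReduce_polyTime` (output of LLL's algorithm is
a reduced basis of the same lattice, Prop. 1.26 termination + (1.4), (1.5)) and `lllReduce_polyTime_holds`
(`LLLMachineMain.lean`: the saturated integral LLL machine runs in polynomial time and computes
`LatticeInstance.lllReduce` on nonsingular input). [cite: LenstraLenstraLovasz1982, Prop. 1.26] -/
theorem lll_polyTime_holds : lll_polyTime := lll_polyTime_of_lllReduce_polyTime lllReduce_polyTime_holds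

end Literature.Algebra.EuclideanLattices
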